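import Summits.ResolutionOfSingularities.ResolutionOfSingularities.Theorems.WildConesCampaignW46FormalChartLe
import Literature.AlgebraicGeometry.Resolution.AdicCompletionRegular
import HarnessLib

/-!
# [OURS · L1 W4.6, rungs (i)/(ii) — the dictionary, SCHEME HALF, brick 5] From the local ring at a rational point
# of the point blow-up to formal-chart recognition: the completed local ring IS `κ⟦X⟧` and `π̂^♯` IS the chart
# substitution

Cell res-hironaka (LADDER-RESOLUTION rung L, D-0089), slot W4.6, seat res-L1-s46-pv-2 (gen 2). Host: route
`WildCones`, crux `ClassicalRegimes` (stmt-ResolutionOfSingularities-16884), `--supports … --as helper`.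

HONEST FRAMING. Everything here is OURS and is ordinary commutative algebra (completion of Noetherian local rings,
Mathlib `AdicCompletion`; the tree's `adicCompletionMap`, `ringKrullDim_adicCompletion`); NOTHING here is a
statement of H. Hironaka's manuscript [Hironaka2017] and nothing of it is used; no FACT-LIST premise. AI review is
weaker than expert review.

## Statement (`exists_ringEquiv_completion_chart`)

Let `g : R → L` be a local homomorphism of Noetherian local rings (in the application `π^♯ : 𝒪_{Z,ξ} → 𝒪_{Z′,ξ′}`),
`E₀ : R̂ ≅ κ⟦X_σ⟧` formal coordinates at `ξ`, and `c : σ → R` generators of `𝔪_R` matching the formal coordinates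
to first order (`E₀(c_j) ≡ X_j mod 𝔪²`). Suppose — this is what bricks 4/4b (`…ChartPoint`, `…ChartPointDim`)
deliver for the local ring of the blow-up of the closed point at a `κ`-RATIONAL point of the exceptional divisor,
chart `cᵢ` — that `g(c_j) = g(cᵢ) e_j`, that `𝔪_L = (g cᵢ) + (e_j − g τ̃_j : j ≠ i)` for some `τ̃ : σ → R`, that
every element of `L` is `≡ g(r)` modulo `𝔪_L`, and `|σ| ≤ dim L`. Let `φ = ĝ ∘ E₀⁻¹ : κ⟦X⟧ → L̂` (`ĝ` the map of
completions) and `τ_j ∈ κ` the constant term of `E₀(τ̃_j)`. Then: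

* `completion_chartData` — `L̂` with `φ` satisfies the hypotheses of formal-chart recognition
  (`FormalChart.exists_ringEquiv_chart`): residually rational, `φ(X_j) = φ(Xᵢ) ẽ_j`, `𝔪_{L̂} = (φ Xᵢ) + (ẽ_j −
  φ τ_j)`, `dim L̂ = |σ|` (the quotients `ẽ_j` are the `e_j` corrected by the unit `φ(Xᵢ)/g(cᵢ) ≡ 1 mod (cᵢ)`
  coming from the second-order discrepancy between `c` and the formal coordinates);
* `exists_ringEquiv_completion_chart` — hence **`L̂ ≅ κ⟦X_σ⟧` by an `E` with `E ∘ φ` = the chart substitution**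
  `Xᵢ ↦ Xᵢ`, `X_j ↦ Xᵢ (X_j + τ_j)`; and `exists_ringEquiv_completion_chart_shear` — the same followed by the
  cleaning shear in a fibre variable `z` (`FormalChart.exists_ringEquiv_chart_shear`).

With bricks 2–3 (`…AtomGerm*`: the atom `z^p − a` goes to `uᵢ^p ·` successor atom under any such `E ∘ φ`;
`MultP`/`Isol` are order / Tjurina conditions) this is the local-ring-to-coefficient dictionary; what remains for
the typed `CampaignW46.Step` is to feed `𝒪_{Z′,ξ′}` (a localisation of the Rees chart, `IsBlowup.exists_reesChart_
stalk`) through bricks 4/4b — scheme-level bookkeeping, next brick.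

References: H. Matsumura, *Commutative Ring Theory* (1986), §8 (completion), Thm. 8.4, 29.7; Mathlib
`Mathlib.RingTheory.AdicCompletion.LocalRing`; tree `AdicQuotient.lean`, `AdicCompletionRegular.lean`;
H. Hironaka, ms. 2017, Th. 16.6 p.84 — ROLE of «the blowup `π : Z′ → Z`» only, under adjudication, not cited as
fact. [Matsumura1987] [folklore]
-/

noncomputable section

-- single-problem summit: the doubled namespace component `ResolutionOfSingularities` is forced
set_option linter.dupNamespace false

open IsLocalRing MvPowerSeries

namespace Summit.ResolutionOfSingularities.ResolutionOfSingularities.Theorems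

namespace CampaignW46.FormalChart

open Literature.AlgebraicGeometry.Resolution

universe u

/-! ## The assembly -/

section Assembly

variable {κ : Type u} [Field κ] {σ : Type} [Fintype σ] [DecidableEq σ]
  {R : Type u} [CommRing R] [IsLocalRing R] [IsNoetherianRing R]
  {L : Type u} [CommRing L] [IsLocalRing L] [IsNoetherianRing L]
  (g : R →+* L) (hg : (maximalIdeal R).map g ≤ maximalIdeal L)
  (E₀ : AdicCompletion (maximalIdeal R) R ≃+* MvPowerSeries σ κ)
  (c : σ → R) (hc : Ideal.span (Set.range c) = maximalIdeal R)
  (hcX : ∀ j, E₀ (algebraMap R (AdicCompletion (maximalIdeal R) R) (c j)) - X j ∈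
    maximalIdeal (MvPowerSeries σ κ) ^ 2)
  (i : σ) (e : σ → L) (he : ∀ j, g (c j) = g (c i) * e j)
  (τ : σ → R)
  (hgen : Ideal.span (Set.range fun j : σ => if j = i then g (c i) else e j - g (τ j)) = maximalIdeal L)
  (hres : ∀ y : L, ∃ r : R, y - g r ∈ maximalIdeal L)

include hc he in
omit [Fintype σ] [DecidableEq σ] [IsNoetherianRing L] in
/-- The extension of `𝔪_R̂` along the map of completions lies in the exceptional ideal `(g cᵢ) L̂`:
`𝔪_R L = (c) L = g(cᵢ) L`. [folklore] -/
theorem map_maximalIdeal_completion_le :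
    (maximalIdeal (AdicCompletion (maximalIdeal R) R)).map
        (adicCompletionMap (maximalIdeal R) (maximalIdeal L) g hg) ≤
      Ideal.span {algebraMap L (AdicCompletion (maximalIdeal L) L) (g (c i))} := by
  rw [AdicCompletion.maximalIdeal_eq_map, Ideal.map_map, Ideal.map_le_iff_le_comap]
  intro x hx
  rw [← hc] at hx
  refine (Ideal.span_le.2 ?_) hx
  rintro _ ⟨j, rfl⟩
  rw [SetLike.mem_coe, Ideal.mem_comap, RingHom.comp_apply, adicCompletionMap_algebraMap, he j, map_mul]
  exact Ideal.mul_mem_right _ _ (Ideal.subset_span rfl)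

include hc he in
omit [Fintype σ] [DecidableEq σ] [IsNoetherianRing L] in
/-- Elements of `𝔪_R̂` go to multiples of `g(cᵢ)`, elements of `𝔪_R̂²` to multiples of `g(cᵢ)²`. [folklore] -/
theorem exists_eq_mul_of_mem_maximalIdeal_pow {k : ℕ} {x : AdicCompletion (maximalIdeal R) R}
    (hx : x ∈ maximalIdeal (AdicCompletion (maximalIdeal R) R) ^ k) :
    ∃ b : AdicCompletion (maximalIdeal L) L, adicCompletionMap (maximalIdeal R) (maximalIdeal L) g hg x =
      algebraMap L (AdicCompletion (maximalIdeal L) L) (g (c i)) ^ k * b := by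
  have hle : (maximalIdeal (AdicCompletion (maximalIdeal R) R) ^ k).map
      (adicCompletionMap (maximalIdeal R) (maximalIdeal L) g hg) ≤
      Ideal.span {algebraMap L (AdicCompletion (maximalIdeal L) L) (g (c i)) ^ k} := by
    rw [Ideal.map_pow, ← Ideal.span_singleton_pow]
    exact Ideal.pow_right_mono (map_maximalIdeal_completion_le g hg c hc i e he) k
  exact Ideal.mem_span_singleton'.1 (hle (Ideal.mem_map_of_mem _ hx)) |>.imp fun b hb => by rw [← hb, mul_comm]

include hc he hcX hgen hres in
omit [Fintype σ] in
/-- [OURS · L1 W4.6 — DICTIONARY, SCHEME HALF, brick 5; replaces the role of «the blowup `π : Z′ → Z` with center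
`D`» (H. Hironaka, ms. 2017, Th. 16.6 p.84) ON COMPLETED LOCAL RINGS, the step from the local ring at a rational
point to recognition; NOT a statement of the manuscript] **The completed local ring at a rational point of the
point blow-up, with `φ = ĝ ∘ E₀⁻¹`, is a formal chart**: it is residually rational over `φ`, `φ(X_j) = φ(Xᵢ) ẽ_j`,
and `𝔪 = (φ Xᵢ) + (ẽ_j − φ τ_j : j ≠ i)` with `τ_j` the constant term of `E₀(τ̃_j)` — the hypotheses of
`FormalChart.exists_ringEquiv_chart`. [folklore] -/
theorem completion_chartData :
    ∃ e' : σ → AdicCompletion (maximalIdeal L) L,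
      (∀ x : AdicCompletion (maximalIdeal L) L, ∃ l : κ,
        x - ((adicCompletionMap (maximalIdeal R) (maximalIdeal L) g hg).comp E₀.symm.toRingHom)
          (MvPowerSeries.C l) ∈ maximalIdeal _) ∧
      (∀ j, j ≠ i → ((adicCompletionMap (maximalIdeal R) (maximalIdeal L) g hg).comp E₀.symm.toRingHom) (X j) =
        ((adicCompletionMap (maximalIdeal R) (maximalIdeal L) g hg).comp E₀.symm.toRingHom) (X i) * e' j) ∧
      Ideal.span (Set.range fun j : σ => if j = i
        then ((adicCompletionMap (maximalIdeal R) (maximalIdeal L) g hg).comp E₀.symm.toRingHom) (X i)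
        else e' j - ((adicCompletionMap (maximalIdeal R) (maximalIdeal L) g hg).comp E₀.symm.toRingHom)
          (MvPowerSeries.C (constantCoeff (E₀ (algebraMap R (AdicCompletion (maximalIdeal R) R) (τ j)))))) =
        maximalIdeal _ := by
  -- notation
  set ĝ := adicCompletionMap (maximalIdeal R) (maximalIdeal L) g hg with hĝ
  set φ : MvPowerSeries σ κ →+* AdicCompletion (maximalIdeal L) L := ĝ.comp E₀.symm.toRingHom with hφ
  set ofL := algebraMap L (AdicCompletion (maximalIdeal L) L) with hofL
  set ofR := algebraMap R (AdicCompletion (maximalIdeal R) R) with hofR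
  set v := ofL (g (c i)) with hv
  have hφ_apply : ∀ f, φ f = ĝ (E₀.symm f) := fun f => rfl
  have hĝ_of : ∀ r : R, ĝ (ofR r) = ofL (g r) := fun r => by
    rw [hofR, hofL, hĝ, adicCompletionMap_algebraMap]
  have h𝔪C : maximalIdeal (AdicCompletion (maximalIdeal L) L) = (maximalIdeal L).map ofL :=
    AdicCompletion.maximalIdeal_eq_map
  have hv𝔪 : v ∈ maximalIdeal (AdicCompletion (maximalIdeal L) L) := by
    rw [h𝔪C]
    exact Ideal.mem_map_of_mem _ (hg (Ideal.mem_map_of_mem _ (hc ▸ Ideal.subset_span ⟨i, rfl⟩)))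
  -- `ĝ` of an element of `𝔪_R̂` is a multiple of `v`
  have hĝ𝔪 : ∀ {x}, x ∈ maximalIdeal (AdicCompletion (maximalIdeal R) R) → ĝ x ∈ Ideal.span {v} := fun hx =>
    map_maximalIdeal_completion_le g hg c hc i e he (Ideal.mem_map_of_mem _ hx)
  -- second-order discrepancy between `c` and the formal coordinates: `φ(X_j) = v e_j − v² b_j`
  have hX : ∀ j, ∃ b, φ (X j) = v * (ofL (e j) - v * b) := by
    intro j
    have h2 : E₀.symm (E₀ (ofR (c j)) - X j) ∈ maximalIdeal (AdicCompletion (maximalIdeal R) R) ^ 2 :=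
      ringEquiv_mem_maximalIdeal_pow E₀.symm (hcX j)
    obtain ⟨b, hb⟩ := exists_eq_mul_of_mem_maximalIdeal_pow g hg c hc i e he h2
    refine ⟨b, ?_⟩
    rw [map_sub, RingEquiv.symm_apply_apply, map_sub] at hb
    rw [hφ_apply, ← sub_sub_cancel (ĝ (ofR (c j))) (ĝ (E₀.symm (X j))), hb, hĝ_of, he j, map_mul, ← hv]
    ring
  have hXi : ∃ b, φ (X i) = v * (1 - v * b) := by
    have h2 : E₀.symm (E₀ (ofR (c i)) - X i) ∈ maximalIdeal (AdicCompletion (maximalIdeal R) R) ^ 2 :=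
      ringEquiv_mem_maximalIdeal_pow E₀.symm (hcX i)
    obtain ⟨b, hb⟩ := exists_eq_mul_of_mem_maximalIdeal_pow g hg c hc i e he h2
    refine ⟨b, ?_⟩
    rw [map_sub, RingEquiv.symm_apply_apply, map_sub] at hb
    rw [hφ_apply, ← sub_sub_cancel (ĝ (ofR (c i))) (ĝ (E₀.symm (X i))), hb, hĝ_of, ← hv]
    ring
  choose b hb using hX
  obtain ⟨bi, hbi⟩ := hXi
  -- the unit `w = 1 − v bᵢ` and the corrected quotients
  have hw : IsUnit (1 - v * bi) :=
    IsLocalRing.isUnit_one_sub_self_of_mem_nonunits _ (Ideal.mul_mem_right _ _ hv𝔪)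
  set w := hw.unit with hw_def
  have hwval : (w : AdicCompletion (maximalIdeal L) L) = 1 - v * bi := by rw [hw_def, IsUnit.unit_spec]
  refine ⟨fun j => (ofL (e j) - v * b j) * (w⁻¹ : (AdicCompletion (maximalIdeal L) L)ˣ), ?_, ?_, ?_⟩
  · -- residual rationality
    intro x
    obtain ⟨ybar, hybar⟩ := (AdicCompletion.residueField_map_bijective L).2 (IsLocalRing.residue _ x)
    obtain ⟨y, rfl⟩ := IsLocalRing.residue_surjective ybar
    obtain ⟨r, hr⟩ := hres y
    refine ⟨constantCoeff (E₀ (ofR r)), ?_⟩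
    have h1 : x - ofL y ∈ maximalIdeal _ := by
      rw [IsLocalRing.ResidueField.map_residue] at hybar
      rw [← Ideal.Quotient.eq]
      exact hybar.symm
    have h2 : ofL y - ofL (g r) ∈ maximalIdeal (AdicCompletion (maximalIdeal L) L) := by
      rw [← map_sub, h𝔪C]; exact Ideal.mem_map_of_mem _ hr
    have h3 : ofL (g r) - φ (MvPowerSeries.C (constantCoeff (E₀ (ofR r)))) ∈
        maximalIdeal (AdicCompletion (maximalIdeal L) L) := by
      rw [← hĝ_of, hφ_apply, ← map_sub]
      refine (Ideal.span_singleton_le_iff_mem _).2 hv𝔪 (hĝ𝔪 ?_)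
      have : E₀.symm (E₀ (ofR r) - MvPowerSeries.C (constantCoeff (E₀ (ofR r)))) ∈
          maximalIdeal (AdicCompletion (maximalIdeal R) R) :=
        ringEquiv_mem_maximalIdeal E₀.symm
          (Literature.RingTheory.MvPowerSeries.Jets.mem_maximalIdeal_iff_constantCoeff_eq_zero.2
            (by rw [map_sub, constantCoeff_C, sub_self]))
      rwa [map_sub, RingEquiv.symm_apply_apply] at this
    have e3 : x - φ (MvPowerSeries.C (constantCoeff (E₀ (ofR r)))) =
        (x - ofL y) + (ofL y - ofL (g r)) + (ofL (g r) - φ (MvPowerSeries.C (constantCoeff (E₀ (ofR r))))) := by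
      ring
    rw [e3]
    exact Ideal.add_mem _ (Ideal.add_mem _ h1 h2) h3
  · -- quotients
    intro j _
    dsimp only
    rw [hb j, hbi, ← hwval]
    have hww : (w : AdicCompletion (maximalIdeal L) L) * (w⁻¹ : (AdicCompletion (maximalIdeal L) L)ˣ) = 1 :=
      Units.mul_inv w
    linear_combination (-(v * (ofL (e j) - v * b j))) * hww
  · -- generators of the maximal ideal, by comparison with the generators coming from `L` modulo `(v)`
    have hgenC : Ideal.span (Set.range fun j : σ => if j = i then v else ofL (e j) - ofL (g (τ j))) =
        maximalIdeal (AdicCompletion (maximalIdeal L) L) := by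
      have hmap := congrArg (Ideal.map ofL) hgen
      rw [Ideal.map_span, ← Set.range_comp] at hmap
      have hF : (fun j : σ => if j = i then v else ofL (e j) - ofL (g (τ j))) =
          ((⇑ofL) ∘ fun j : σ => if j = i then g (c i) else e j - g (τ j)) := by
        funext j
        by_cases hji : j = i
        · rw [Function.comp_apply, if_pos hji, if_pos hji, hv]
        · rw [Function.comp_apply, if_neg hji, if_neg hji, map_sub]
      rw [h𝔪C, ← hmap, hF]
    -- the two generating families agree modulo `(v)`, and both contain `v` up to a unit
    have hτj : ∀ j, ofL (g (τ j)) - φ (MvPowerSeries.C (constantCoeff (E₀ (ofR (τ j))))) ∈ Ideal.span {v} := by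
      intro j
      rw [← hĝ_of, hφ_apply, ← map_sub]
      refine hĝ𝔪 ?_
      have : E₀.symm (E₀ (ofR (τ j)) - MvPowerSeries.C (constantCoeff (E₀ (ofR (τ j))))) ∈
          maximalIdeal (AdicCompletion (maximalIdeal R) R) :=
        ringEquiv_mem_maximalIdeal E₀.symm
          (Literature.RingTheory.MvPowerSeries.Jets.mem_maximalIdeal_iff_constantCoeff_eq_zero.2
            (by rw [map_sub, constantCoeff_C, sub_self]))
      rwa [map_sub, RingEquiv.symm_apply_apply] at this
    have hej : ∀ j, (ofL (e j) - v * b j) * (w⁻¹ : (AdicCompletion (maximalIdeal L) L)ˣ) - ofL (e j) ∈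
        Ideal.span {v} := by
      intro j
      have e1 : (ofL (e j) - v * b j) * (w⁻¹ : (AdicCompletion (maximalIdeal L) L)ˣ) - ofL (e j) =
          v * ((ofL (e j) * bi - b j) * (w⁻¹ : (AdicCompletion (maximalIdeal L) L)ˣ)) := by
        have e2 : ofL (e j) = ofL (e j) * (w : AdicCompletion (maximalIdeal L) L) *
            (w⁻¹ : (AdicCompletion (maximalIdeal L) L)ˣ) := by
          rw [mul_assoc, Units.mul_inv, mul_one]
        calc (ofL (e j) - v * b j) * (w⁻¹ : (AdicCompletion (maximalIdeal L) L)ˣ) - ofL (e j)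
            = (ofL (e j) - v * b j) * (w⁻¹ : (AdicCompletion (maximalIdeal L) L)ˣ) -
                ofL (e j) * (w : AdicCompletion (maximalIdeal L) L) *
                  (w⁻¹ : (AdicCompletion (maximalIdeal L) L)ˣ) := by rw [← e2]
          _ = v * ((ofL (e j) * bi - b j) * (w⁻¹ : (AdicCompletion (maximalIdeal L) L)ˣ)) := by
            rw [hwval]; ring
      rw [e1]
      exact Ideal.mul_mem_right _ _ (Ideal.subset_span rfl)
    rw [← hgenC]
    apply le_antisymm
    · rw [Ideal.span_le]
      rintro _ ⟨j, rfl⟩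
      have hvmem : v ∈ Ideal.span (Set.range fun j : σ => if j = i then v else ofL (e j) - ofL (g (τ j))) :=
        Ideal.subset_span ⟨i, by simp⟩
      have hspan : Ideal.span {v} ≤
          Ideal.span (Set.range fun j : σ => if j = i then v else ofL (e j) - ofL (g (τ j))) :=
        (Ideal.span_singleton_le_iff_mem _).2 hvmem
      by_cases hji : j = i
      · simp only [hji, if_true, SetLike.mem_coe, hbi]
        exact Ideal.mul_mem_right _ _ hvmem
      · simp only [if_neg hji, SetLike.mem_coe]
        have e1 : (ofL (e j) - v * b j) * (w⁻¹ : (AdicCompletion (maximalIdeal L) L)ˣ) -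
            φ (MvPowerSeries.C (constantCoeff (E₀ (ofR (τ j))))) =
            (ofL (e j) - ofL (g (τ j))) +
              (((ofL (e j) - v * b j) * (w⁻¹ : (AdicCompletion (maximalIdeal L) L)ˣ) - ofL (e j)) +
                (ofL (g (τ j)) - φ (MvPowerSeries.C (constantCoeff (E₀ (ofR (τ j))))))) := by ring
        rw [e1]
        exact Ideal.add_mem _ (Ideal.subset_span ⟨j, by simp [hji]⟩)
          (hspan (Ideal.add_mem _ (hej j) (hτj j)))
    · rw [Ideal.span_le]
      rintro _ ⟨j, rfl⟩
      have hvmem : v ∈ Ideal.span (Set.range fun j : σ => if j = i then φ (X i)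
          else (ofL (e j) - v * b j) * (w⁻¹ : (AdicCompletion (maximalIdeal L) L)ˣ) -
            φ (MvPowerSeries.C (constantCoeff (E₀ (ofR (τ j)))))) := by
        have h1 : φ (X i) ∈ Ideal.span (Set.range fun j : σ => if j = i then φ (X i)
            else (ofL (e j) - v * b j) * (w⁻¹ : (AdicCompletion (maximalIdeal L) L)ˣ) -
              φ (MvPowerSeries.C (constantCoeff (E₀ (ofR (τ j)))))) := Ideal.subset_span ⟨i, by simp⟩
        have e1 : v = φ (X i) * (w⁻¹ : (AdicCompletion (maximalIdeal L) L)ˣ) := by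
          rw [hbi, ← hwval, mul_assoc, Units.mul_inv, mul_one]
        have h2 := Ideal.mul_mem_right ((w⁻¹ : (AdicCompletion (maximalIdeal L) L)ˣ) : AdicCompletion (maximalIdeal L) L) _ h1
        rwa [← e1] at h2
      have hspan : Ideal.span {v} ≤ Ideal.span (Set.range fun j : σ => if j = i then φ (X i)
          else (ofL (e j) - v * b j) * (w⁻¹ : (AdicCompletion (maximalIdeal L) L)ˣ) -
            φ (MvPowerSeries.C (constantCoeff (E₀ (ofR (τ j)))))) :=
        (Ideal.span_singleton_le_iff_mem _).2 hvmem
      by_cases hji : j = i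
      · simp only [hji, if_true, SetLike.mem_coe]
        exact hvmem
      · simp only [if_neg hji, SetLike.mem_coe]
        have e1 : ofL (e j) - ofL (g (τ j)) =
            ((ofL (e j) - v * b j) * (w⁻¹ : (AdicCompletion (maximalIdeal L) L)ˣ) -
              φ (MvPowerSeries.C (constantCoeff (E₀ (ofR (τ j)))))) -
              (((ofL (e j) - v * b j) * (w⁻¹ : (AdicCompletion (maximalIdeal L) L)ˣ) - ofL (e j)) +
                (ofL (g (τ j)) - φ (MvPowerSeries.C (constantCoeff (E₀ (ofR (τ j))))))) := by ring
        rw [e1]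
        exact Ideal.sub_mem _ (Ideal.subset_span ⟨j, by simp [hji]⟩)
          (hspan (Ideal.add_mem _ (hej j) (hτj j)))

include hc he hcX hgen hres in
/-- [OURS · L1 W4.6 — DICTIONARY, SCHEME HALF, brick 5, MAIN; replaces the role of «the blowup `π : Z′ → Z` with
center `D`» (H. Hironaka, ms. 2017, Th. 16.6 p.84) ON COMPLETED LOCAL RINGS; NOT a statement of the manuscript]
**Formal-chart recognition for the local ring at a rational point of the point blow-up.** Under the ring-level
hypotheses of this section (delivered by bricks 4/4b for `𝒪_{Z′,ξ′}`) and `|σ| ≤ dim L`: `L̂ ≅ κ⟦X_σ⟧` by an `E`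
with `E ∘ ĝ ∘ E₀⁻¹` fixing constants, `↦ Xᵢ` on `Xᵢ` and `↦ Xᵢ (X_j + τ_j)` on `X_j` (`j ≠ i`), where
`τ_j ∈ κ` is the constant term of `E₀(τ̃_j)`. [cite: Matsumura1987, Thm. 29.7] [folklore] -/
theorem exists_ringEquiv_completion_chart (hdim : (Fintype.card σ : WithBot ℕ∞) ≤ ringKrullDim L) :
    ∃ E : AdicCompletion (maximalIdeal L) L ≃+* MvPowerSeries σ κ,
      (∀ l, E (((adicCompletionMap (maximalIdeal R) (maximalIdeal L) g hg).comp E₀.symm.toRingHom)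
        (MvPowerSeries.C l)) = MvPowerSeries.C l) ∧
      E (((adicCompletionMap (maximalIdeal R) (maximalIdeal L) g hg).comp E₀.symm.toRingHom) (X i)) = X i ∧
      ∀ j, j ≠ i → E (((adicCompletionMap (maximalIdeal R) (maximalIdeal L) g hg).comp E₀.symm.toRingHom) (X j)) =
        X i * (X j + MvPowerSeries.C (constantCoeff (E₀ (algebraMap R (AdicCompletion (maximalIdeal R) R) (τ j))))) := by
  haveI : IsNoetherianRing (AdicCompletion (maximalIdeal L) L) := isNoetherianRing_adicCompletion_maximalIdeal L
  obtain ⟨e', hres', he', hgen'⟩ := completion_chartData g hg E₀ c hc hcX i e he τ hgen hres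
  have hdim' : (Fintype.card σ : WithBot ℕ∞) ≤ ringKrullDim (AdicCompletion (maximalIdeal L) L) := by
    rw [ringKrullDim_adicCompletion]; exact hdim
  obtain ⟨E, hC, hi, -, hj⟩ := exists_ringEquiv_chart_of_le _ hres' i e' he' _ hgen' hdim'
  exact ⟨E, hC, hi, hj⟩

include hc he hcX hgen hres in
/-- [OURS · L1 W4.6 — DICTIONARY, SCHEME HALF, brick 5, MAIN with CLEANING; NOT a statement of the manuscript] The same
followed by the shear of a fibre variable `z ≠ i` by a series `s` (`s(0) = 0`, no `z`): `E (φ X_z) =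
Xᵢ (X_z + τ_z + s)` — the form in which brick 2 (`AtomGerm.ringHom_atom_eq`) reads the controlled transform of the
atom. [cite: Matsumura1987, Thm. 29.7] [folklore] -/
theorem exists_ringEquiv_completion_chart_shear (hdim : (Fintype.card σ : WithBot ℕ∞) ≤ ringKrullDim L)
    (z : σ) (hz : z ≠ i) (s : MvPowerSeries σ κ) (hs0 : constantCoeff s = 0)
    (hs : subst (fun j : σ => if j = z then (0 : MvPowerSeries σ κ) else X j) s = s) :
    ∃ E : AdicCompletion (maximalIdeal L) L ≃+* MvPowerSeries σ κ,
      (∀ l, E (((adicCompletionMap (maximalIdeal R) (maximalIdeal L) g hg).comp E₀.symm.toRingHom)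
        (MvPowerSeries.C l)) = MvPowerSeries.C l) ∧
      E (((adicCompletionMap (maximalIdeal R) (maximalIdeal L) g hg).comp E₀.symm.toRingHom) (X i)) = X i ∧
      (∀ j, j ≠ i → j ≠ z →
        E (((adicCompletionMap (maximalIdeal R) (maximalIdeal L) g hg).comp E₀.symm.toRingHom) (X j)) =
          X i * (X j + MvPowerSeries.C (constantCoeff (E₀ (algebraMap R (AdicCompletion (maximalIdeal R) R) (τ j)))))) ∧
      E (((adicCompletionMap (maximalIdeal R) (maximalIdeal L) g hg).comp E₀.symm.toRingHom) (X z)) =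
        X i * (X z + MvPowerSeries.C (constantCoeff (E₀ (algebraMap R (AdicCompletion (maximalIdeal R) R) (τ z)))) + s) := by
  haveI : IsNoetherianRing (AdicCompletion (maximalIdeal L) L) := isNoetherianRing_adicCompletion_maximalIdeal L
  obtain ⟨e', hres', he', hgen'⟩ := completion_chartData g hg E₀ c hc hcX i e he τ hgen hres
  have hdim' : (Fintype.card σ : WithBot ℕ∞) ≤ ringKrullDim (AdicCompletion (maximalIdeal L) L) := by
    rw [ringKrullDim_adicCompletion]; exact hdim
  exact exists_ringEquiv_chart_shear_of_le _ hres' i e' he' _ hgen' hdim' z hz s hs0 hs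

end Assembly

end CampaignW46.FormalChart

end Summit.ResolutionOfSingularities.ResolutionOfSingularities.Theorems

end
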